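import Mathlib
import Literature.NumberTheory.Transcendental.GammaIsoCross
import Literature.NumberTheory.Transcendental.GammaIsoAlgebraicStep

/-!
# Sub-goal `caseII_algPartner` (line `eac-extends-core-automorphisms`, crux stmt-Schanuel-0968)

**Γ-isomorphisms at algebraic steps.** Let `F` be an exponential field, `K ≤ F` a `ℚ`-subspace,
`c` a finite tuple, `X = K + ℚc`, and `E = K₀(allGens c)` the Γ-field of `X`
(`K₀ = ℚ(K, exp K) = GammaField.fieldOf K`; `E = ℚ(gens X)` as a set,
`GammaField.mem_adjoinField_allGens_iff`). If `v` is algebraic over `E`, `v'` is a root of the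
minimal polynomial of `v` over `E` (an `E`-conjugate of `v`), and `exp v` (resp. `exp v'`) is
transcendental over `ℚ(gens X, v)` (resp. `ℚ(gens X, v')`), then `(c, v) ↦ (c, v')` is a
Γ-isomorphism over `K` at all Kummer levels (`algPartner_isGammaIso`). Specialised to `ℂ` and
`K = ℚτ` and restated as a cross Γ-isomorphism over the identity of `ℚ(ℚτ, exp ℚτ)`
(`GammaField.IsGammaIsoTw₂ (RingEquiv.refl _)`), this is the registered sub-goal
`caseII_algPartner` (building block for the A-step of `stub_caseII`) of the reshaped line
`eac-extends-core-automorphisms` of crux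
`Summit.Schanuel.Schanuel.Theses.RigidCore.AclSubsetLogFreeCore` (stmt-Schanuel-0968).

Proof (Bays–Kirby 2018, §4.4, proof of Thm 4.17, algebraic case). This is the tree's algebraic
step `GammaField.IsGammaIso.append_single_of_minpoly` (file `GammaIsoAlgebraicStep.lean`) for the
identity Γ-isomorphism `c ↦ c` (`GammaField.IsGammaIso.refl`): its field isomorphism
`θ : E ≃ E` is the identity (`coe_fieldEquiv_refl`, by `IntermediateField.adjoin_algHom_ext`:
`θ` is `K₀`-linear and fixes all division points `lvGens M c`), so "`v'` is a root of `θ(minpoly v)`"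
is the hypothesis `hvv'`; at each level `M` the relation ideal of `(c, v ; exp (c/M!), exp (v/M!))`
over `K₀` is that of `(v ; c, exp (c/M!))` — determined by `minpoly_E v = minpoly_E v'` — extended
by the element `exp (v/M!)`, which is transcendental over `K₀[v, c, exp (c/M!)] ⊆ acl (gens X ∪ {v})`
because its `M!`-th power `exp v` is (`ZilberHomogeneity.ker_aeval_sumElim_eq`). Finally
`Fin.append c ![v] = Fin.snoc c v` (`Fin.append_right_eq_snoc`) and a Γ-isomorphism over `K` is a
cross Γ-isomorphism over `RingEquiv.refl K₀` (`GammaField.isGammaIsoTw₂_iff_isGammaIsoTw`,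
`GammaField.IsGammaIso.isGammaIsoTw_refl`). No hypothesis `τ = 2πi` is needed.

## References

* M. Bays, J. Kirby, *Pseudo-exponential maps, variants, and quasiminimality*, Algebra & Number
  Theory 12 (2018) 493–549: Def. 3.10, §4.4 (Thm 4.17 and its proof).
-/

noncomputable section

-- the namespace `Summit.Schanuel.Schanuel.…` (problem = summit, D-0022) trips the duplicated-namespace
-- linter on every declaration; the project lakefile disables it for the same reason.
set_option linter.dupNamespace false

open Set
open Literature.ModelTheory.ExponentialFields Literature.ModelTheory.ExponentialFields.ExponentialRing
open Literature.NumberTheory.Transcendental Literature.NumberTheory.Transcendental.GammaField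

universe u

namespace Summit.Schanuel.Schanuel.Theorems.RigidCore

variable {F : Type u} [Field F] [CharZero F] [ExponentialRing F]

/-- **The field isomorphism of the identity Γ-isomorphism is the identity**: for
`h = IsGammaIso.refl K c`, `h.fieldEquiv : K₀(allGens c) ≃ K₀(allGens c)` is `K₀`-linear and fixes
every division point `lvGens M c j`, hence is the inclusion (`IntermediateField.adjoin_algHom_ext`).
[folklore] -/
theorem coe_fieldEquiv_refl (K : Submodule ℚ F) {N : ℕ} (c : Fin N → F)
    (z : IntermediateField.adjoin (fieldOf K) (allGens c)) :
    ((IsGammaIso.refl K c).fieldEquiv z : F) = z := by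
  set h : IsGammaIso K c c := IsGammaIso.refl K c with hh
  let f : IntermediateField.adjoin (fieldOf K) (allGens c) →ₐ[fieldOf K] F :=
    { (algebraMap (IntermediateField.adjoin (fieldOf K) (allGens c)) F).comp
        (h.fieldEquiv : _ →+* _) with
      commutes' := fun k => by
        show (h.fieldEquiv (algebraMap (fieldOf K) _ k) : F) = k
        exact h.coe_fieldEquiv_algebraMap k }
  have hfg : f = (IntermediateField.adjoin (fieldOf K) (allGens c)).val := by
    refine IntermediateField.adjoin_algHom_ext (fieldOf K) ?_
    rintro _ ⟨_, ⟨M, rfl⟩, ⟨j, rfl⟩⟩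
    show (h.fieldEquiv _ : F) = lvGens M c j
    exact h.coe_fieldEquiv_lvGens M j
  exact congrArg (fun φ : _ →ₐ[fieldOf K] F => φ z) hfg

/-- **Γ-isomorphisms at algebraic steps** (Bays–Kirby 2018, §4.4, proof of Thm 4.17, algebraic
case; one exponential field, any base `K`). With `E = K₀(allGens c)` the Γ-field of `X = K + ℚc`:
if `v` is algebraic over `E`, `v'` is a root of `minpoly_E v`, and `exp v ∉ acl (gens X ∪ {v})`,
`exp v' ∉ acl (gens X ∪ {v'})`, then `(c, v) ↦ (c, v')` is a Γ-isomorphism over `K`. From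
`GammaField.IsGammaIso.append_single_of_minpoly` applied to `IsGammaIso.refl K c`, whose field
isomorphism is the identity (`coe_fieldEquiv_refl`). [cite: BaysKirby2018ANT, §4.4 (Thm 4.17, proof)] -/
theorem algPartner_isGammaIso (K : Submodule ℚ F) {N : ℕ} (c : Fin N → F) (v v' : F)
    (hv : IsAlgebraic (IntermediateField.adjoin (fieldOf K) (allGens c)) v)
    (hvv' : Polynomial.aeval v' (minpoly (IntermediateField.adjoin (fieldOf K) (allGens c)) v) = 0)
    (hT : exp v ∉ acl (gens (K ⊔ Submodule.span ℚ (range c)) ∪ {v}))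
    (hT' : exp v' ∉ acl (gens (K ⊔ Submodule.span ℚ (range c)) ∪ {v'})) :
    IsGammaIso K (Fin.snoc c v) (Fin.snoc c v') := by
  set E := IntermediateField.adjoin (fieldOf K) (allGens c) with hE
  have h0 : IsGammaIso K c c := IsGammaIso.refl K c
  have hθ : (algebraMap E F).comp h0.fieldEquiv.toRingHom = algebraMap E F :=
    RingHom.ext fun z => coe_fieldEquiv_refl K c z
  have hx' : Polynomial.eval₂ ((algebraMap E F).comp h0.fieldEquiv.toRingHom) v' (minpoly E v) = 0 := by
    rw [hθ]
    exact hvv'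
  rw [union_singleton] at hT hT'
  have h := h0.append_single_of_minpoly hv.isIntegral hx' hT hT'
  rwa [Fin.append_right_eq_snoc, Fin.append_right_eq_snoc, Matrix.cons_val_fin_one,
    Matrix.cons_val_fin_one] at h

/-- **Sub-goal `caseII_algPartner` — Γ-isomorphisms at algebraic steps, over `ℚτ` in `ℂ`.** For
`τ ∈ ℂ`, a tuple `c`, `E = ℚ(ℚτ, exp ℚτ)(allGens c)` the Γ-field of `X = ℚτ + ℚc`: if `v` is
algebraic over `E`, `v'` is a root of `minpoly_E v`, and `exp v ∉ acl (gens X ∪ {v})`,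
`exp v' ∉ acl (gens X ∪ {v'})`, then `(c, v) ↦ (c, v')` is a cross Γ-isomorphism over the
identity of `ℚ(ℚτ, exp ℚτ)` (all Kummer levels). From `algPartner_isGammaIso` and
`GammaField.isGammaIsoTw₂_iff_isGammaIsoTw`. [cite: BaysKirby2018ANT, §4.4 (Thm 4.17, proof)] -/
theorem caseII_algPartner (τ : ℂ) {N : ℕ} (c : Fin N → ℂ) (v v' : ℂ)
    (hv : IsAlgebraic (IntermediateField.adjoin (fieldOf (Submodule.span ℚ ({τ} : Set ℂ))) (allGens c)) v)
    (hvv' : Polynomial.aeval v'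
      (minpoly (IntermediateField.adjoin (fieldOf (Submodule.span ℚ ({τ} : Set ℂ))) (allGens c)) v) = 0)
    (hT : Complex.exp v ∉ acl (gens (Submodule.span ℚ ({τ} : Set ℂ) ⊔ Submodule.span ℚ (range c)) ∪ {v}))
    (hT' : Complex.exp v' ∉ acl (gens (Submodule.span ℚ ({τ} : Set ℂ) ⊔ Submodule.span ℚ (range c)) ∪ {v'})) :
    IsGammaIsoTw₂ (RingEquiv.refl (fieldOf (Submodule.span ℚ ({τ} : Set ℂ)))) (Fin.snoc c v) (Fin.snoc c v') :=
  isGammaIsoTw₂_iff_isGammaIsoTw.2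
    (algPartner_isGammaIso (Submodule.span ℚ ({τ} : Set ℂ)) c v v' hv hvv' hT hT').isGammaIsoTw_refl

end Summit.Schanuel.Schanuel.Theorems.RigidCore
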